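import Summits.Ventures.LatticeQCDFlow.Scaling.SectorFreshStep

/-!
HONEST FRAMING: exact (Metropolis-corrected) sampling algorithms for lattice gauge theory; figures
of merit are autocorrelation/cost numbers at stated couplings and volumes; no continuum-physics
claim.

# SectorFreshness — UNDER SECTOR-EXACT TRANSPORT EVERY NON-PRIMORDIAL COORDINATE IS EXACTLY DISTRIBUTED WITHIN ITS SECTOR:
# SECTOR-FRESH-EXCHANGEABILITY `λ̂_n(z[j ↦ v], D)·μ_j(z_j) = λ̂_n(z, D)·μ_j(v)` (`j ∉ D`, `ℓ v = ℓ z_j`) HOLDS AT ALL TIMES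
# FROM `δ_{(x, univ)}`, FOR THE EXACT HOT SAMPLER AND SECTOR-CONFINED STATIONARY COLD UPDATES (lean-2 GEN-30, ours)

Venture-side (OURS).  Cell `lqcd-flow` (pub-lqcd), unit `pub-lqcd-lean-2-g30`, 2026-08-28.  Chapter Q (item 1 for sector-exact maps on a
general `S`), file 3: the pieces of `Scaling/SectorFreshStep` assembled along chapter M's one-step formula `dom_stepLaw_apply` at `γ = α`,
`B = id`, and the induction over time — as `Scaling/DominatedStarFreshness` did for plain freshness.

## What is proved

* **`sfresh_entry_piece`** — the entry piece `𝟙{D' = σ_r D}·λ(y_r z', D)α_r(y_r z') + 𝟙{D' = D}·(λ(y_r z', D)·0 + λ(z', D)(1 − α_r(z')))`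
  is sector-fresh at every `j ∉ D'`;
* **`sector_fresh_step`** — sector-fresh-exchangeability is preserved by one step of `P̂`;
* **`sector_fresh_lawAt`** — it holds for `λ̂_n = δ_{(x, univ)}P̂ⁿ` at all times (`μ > 0`, label-preserving sector-exact maps, exact hot
  sampler, `μ_k`-stationary sector-confined cold kernels).

Reading (no numerics implied): GEN-29's weight-process reduction in its two-valued case — given the stale set, the stale contents and
ALL the sector labels, the fresh contents are independent draws from their cold laws conditioned on their sectors.  This is the
certificate no tag chain could give for general maps (a rejection biases a fresh value through its weight); with sector-exact maps the
weight is a function of the label, so conditioning on labels removes the bias.  NOT CLAIMED here: the distance to `π̃` (files 4–5).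
Literature grade (cell rule): OWN; nothing cited as a fact; no new bib keys.
-/

noncomputable section

open Finset Function
open Literature.Probability.MarkovChains

namespace Summit.Ventures.LatticeQCDFlow.Scaling

variable {S : Type*} [Fintype S] [DecidableEq S] {K m : ℕ} {μ : Fin (K + 1) → S → ℝ} {M : Fin (K + 1) → S → S → ℝ}
  {w : Fin (K + 1) → ℝ} {t : ℝ}

section SFreshness
variable (κ : Fin m → Fin K) (φ : Fin m → Equiv.Perm S) {L : Type*} (ℓ : S → L)

omit [Fintype S] [DecidableEq S] in
/-- **THE ENTRY PIECE IS SECTOR-FRESH** (source tag `D`, target tag `D'`, `j ∉ D'`, `v` in the sector of `z'_j`; `λ` sector-fresh on every tag). [ours] -/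
theorem sfresh_entry_piece (hφℓ : ∀ r u, ℓ (φ r u) = ℓ u) {cL : Fin m → L → ℝ} (hcL : ∀ r b, 0 < cL r b)
    (hexact : ∀ r u, μ (κ r).succ (φ r u) = cL r (ℓ u) * μ 0 u)
    {α : Fin m → (Fin (K + 1) → S) → ℝ}
    (hαoff : ∀ (r : Fin m) (z : Fin (K + 1) → S) (j : Fin (K + 1)) (v : S), j ≠ 0 → j ≠ (κ r).succ → α r (update z j v) = α r z)
    (hαlab : ∀ (r : Fin m) (z z' : Fin (K + 1) → S), ℓ (z 0) = ℓ (z' 0) → ℓ (z (κ r).succ) = ℓ (z' (κ r).succ) → α r z = α r z')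
    {lam : (Fin (K + 1) → S) × Finset (Fin (K + 1)) → ℝ}
    (hlam : ∀ (z : Fin (K + 1) → S) (D : Finset (Fin (K + 1))) (j : Fin (K + 1)) (v : S), j ∉ D → ℓ v = ℓ (z j) →
      lam (update z j v, D) * μ j (z j) = lam (z, D) * μ j v)
    (r : Fin m) (D D' : Finset (Fin (K + 1))) {j : Fin (K + 1)} (hj : j ∉ D') (z' : Fin (K + 1) → S) (v : S)
    (hv : ℓ v = ℓ (z' j)) :
    ((if D' = D.image (Equiv.swap (0 : Fin (K + 1)) (κ r).succ) then (1 : ℝ) else 0)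
          * (lam (edgeFlowSwap (φ r) 0 (κ r).succ (update z' j v), D)
              * (fun r a => α r a.1) r (edgeFlowSwap (φ r) 0 (κ r).succ (update z' j v), D))
        + (if D' = (fun (_ : Fin m) (D : Finset (Fin (K + 1))) => D) r D then (1 : ℝ) else 0)
          * (lam (edgeFlowSwap (φ r) 0 (κ r).succ (update z' j v), D)
              * (α r (edgeFlowSwap (φ r) 0 (κ r).succ (update z' j v))
                - (fun r a => α r a.1) r (edgeFlowSwap (φ r) 0 (κ r).succ (update z' j v), D))
            + lam (update z' j v, D) * (1 - α r (update z' j v)))) * μ j (z' j)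
      = ((if D' = D.image (Equiv.swap (0 : Fin (K + 1)) (κ r).succ) then (1 : ℝ) else 0)
          * (lam (edgeFlowSwap (φ r) 0 (κ r).succ z', D) * (fun r a => α r a.1) r (edgeFlowSwap (φ r) 0 (κ r).succ z', D))
        + (if D' = (fun (_ : Fin m) (D : Finset (Fin (K + 1))) => D) r D then (1 : ℝ) else 0)
          * (lam (edgeFlowSwap (φ r) 0 (κ r).succ z', D)
              * (α r (edgeFlowSwap (φ r) 0 (κ r).succ z') - (fun r a => α r a.1) r (edgeFlowSwap (φ r) 0 (κ r).succ z', D))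
            + lam (z', D) * (1 - α r z'))) * μ j v := by
  dsimp only
  simp only [sub_self, mul_zero, zero_add]
  rw [add_mul, add_mul]
  congr 1
  · -- the accepted piece: only when `D' = σ_r D`, i.e. `D = σ_r D'`
    by_cases hD : D' = D.image (Equiv.swap (0 : Fin (K + 1)) (κ r).succ)
    · have hDD : D = D'.image (Equiv.swap (0 : Fin (K + 1)) (κ r).succ) := by
        rw [hD, Finset.image_image]
        have : (⇑(Equiv.swap (0 : Fin (K + 1)) (κ r).succ) ∘ ⇑(Equiv.swap (0 : Fin (K + 1)) (κ r).succ)) = id := by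
          funext i; simp [Equiv.swap_apply_self]
        rw [this, Finset.image_id]
      rw [if_pos hD, one_mul, one_mul]
      subst hDD
      exact sfresh_accept_piece κ φ ℓ hφℓ hcL hexact hαoff hαlab r (fun z i u hi hu => hlam z _ i u hi hu) hj z' v hv
    · rw [if_neg hD, zero_mul, zero_mul, zero_mul, zero_mul]
  · -- the rejected piece: only when `D' = D`
    by_cases hD : D' = D
    · rw [if_pos hD, one_mul, one_mul]
      subst hD
      exact sfresh_reject_piece κ ℓ hαoff hαlab r (fun z i u hi hu => hlam z _ i u hi hu) hj z' v hv
    · rw [if_neg hD, zero_mul, zero_mul, zero_mul, zero_mul]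

/-- **ONE STEP OF `P̂` PRESERVES SECTOR-FRESH-EXCHANGEABILITY** (`μ > 0`, sector-exact maps preserving `A`, exact hot sampler,
`μ_k`-stationary sector-confined cold kernels). [ours] -/
theorem sector_fresh_step (hμ : ∀ k x, 0 < μ k x) (hφℓ : ∀ r u, ℓ (φ r u) = ℓ u) {cL : Fin m → L → ℝ} (hcL : ∀ r b, 0 < cL r b)
    (hexact : ∀ r u, μ (κ r).succ (φ r u) = cL r (ℓ u) * μ 0 u)
    (hM0 : ∀ u v, M 0 u v = μ 0 v) (hstat : ∀ k : Fin (K + 1), k ≠ 0 → ∀ v, ∑ u, μ k u * M k u v = μ k v)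
    (hconf : ∀ k : Fin (K + 1), k ≠ 0 → ∀ u v, ℓ u ≠ ℓ v → M k u v = 0)
    {α : Fin m → (Fin (K + 1) → S) → ℝ}
    (hα : ∀ r z, α r z = min 1 (tensorFun μ (edgeFlowSwap (φ r) 0 (κ r).succ z) / tensorFun μ z))
    {Ph : (Fin (K + 1) → S) × Finset (Fin (K + 1)) → (Fin (K + 1) → S) × Finset (Fin (K + 1)) → ℝ}
    (hPh : ∀ a b, Ph a b = ∑ r : Fin m, t / m *
        ((fun r a => α r a.1) r a * (if b.1 = edgeFlowSwap (φ r) 0 (κ r).succ a.1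
            ∧ b.2 = a.2.image (Equiv.swap (0 : Fin (K + 1)) (κ r).succ) then (1 : ℝ) else 0)
          + (α r a.1 - (fun r a => α r a.1) r a) * (if b.1 = edgeFlowSwap (φ r) 0 (κ r).succ a.1
            ∧ b.2 = (fun (_ : Fin m) (D : Finset (Fin (K + 1))) => D) r a.2 then (1 : ℝ) else 0)
          + (1 - α r a.1) * (if b.1 = a.1 ∧ b.2 = (fun (_ : Fin m) (D : Finset (Fin (K + 1))) => D) r a.2 then (1 : ℝ) else 0))
      + (1 - t) * ∑ k : Fin (K + 1), w k * (coordKernel M k a.1 b.1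
          * (if b.2 = (if k = 0 then a.2.erase 0 else a.2) then (1 : ℝ) else 0)))
    {lam : (Fin (K + 1) → S) × Finset (Fin (K + 1)) → ℝ}
    (hlam : ∀ (z : Fin (K + 1) → S) (D : Finset (Fin (K + 1))) (j : Fin (K + 1)) (v : S), j ∉ D → ℓ v = ℓ (z j) →
      lam (update z j v, D) * μ j (z j) = lam (z, D) * μ j v) :
    ∀ (z : Fin (K + 1) → S) (D : Finset (Fin (K + 1))) (j : Fin (K + 1)) (v : S), j ∉ D → ℓ v = ℓ (z j) →
      stepLaw Ph lam (update z j v, D) * μ j (z j) = stepLaw Ph lam (z, D) * μ j v := by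
  have hαoff : ∀ (r : Fin m) (z : Fin (K + 1) → S) (j : Fin (K + 1)) (v : S), j ≠ 0 → j ≠ (κ r).succ →
      α r (update z j v) = α r z := fun r z j v hj0 hjl => accept_update_of_ne κ φ hμ hα r z hj0 hjl v
  have hαlab : ∀ (r : Fin m) (z z' : Fin (K + 1) → S), ℓ (z 0) = ℓ (z' 0) → ℓ (z (κ r).succ) = ℓ (z' (κ r).succ) →
      α r z = α r z' := fun r z z' h0 hl => sectorExact_accept_labels κ φ ℓ hμ hφℓ hcL hexact hα r h0 hl
  intro z' D' j v hj hv
  rw [dom_stepLaw_apply κ φ (γ := fun r a => α r a.1) (Bset := fun (_ : Fin m) (D : Finset (Fin (K + 1))) => D) hPh lam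
      (update z' j v) D',
    dom_stepLaw_apply κ φ (γ := fun r a => α r a.1) (Bset := fun (_ : Fin m) (D : Finset (Fin (K + 1))) => D) hPh lam z' D',
    add_mul, add_mul, Finset.sum_mul, Finset.sum_mul]
  congr 1
  · refine sum_congr rfl fun r _ => ?_
    rw [mul_assoc, mul_assoc, Finset.sum_mul, Finset.sum_mul]
    congr 1
    refine sum_congr rfl fun D _ => ?_
    exact sfresh_entry_piece κ φ ℓ hφℓ hcL hexact hαoff hαlab hlam r D D' hj z' v hv
  · rw [mul_assoc, mul_assoc]
    congr 1
    rw [Finset.sum_mul, Finset.sum_mul]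
    refine sum_congr rfl fun k _ => ?_
    rw [mul_assoc, mul_assoc]
    congr 1
    rw [Finset.sum_mul, Finset.sum_mul]
    refine sum_congr rfl fun D hD => ?_
    have hD' := (Finset.mem_filter.mp hD).2
    by_cases hk : k = 0
    · subst hk
      rw [if_pos rfl] at hD'
      have hjD : j ≠ 0 → j ∉ D := fun hj0 h => hj (hD' ▸ Finset.mem_erase.mpr ⟨hj0, h⟩)
      simp_rw [hM0]
      exact sfresh_hot_update ℓ (fun hj0 z u hu => hlam z D j u (hjD hj0) hu) z' v (fun _ => hv)
    · rw [if_neg hk] at hD'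
      subst hD'
      exact sfresh_cold_update ℓ hμ (hstat k hk) (hconf k hk) (fun z i u hi hu => hlam z D i u hi hu) z' hj v hv

/-- **SECTOR-FRESH-EXCHANGEABILITY AT ALL TIMES:** from `δ_{(x, univ)}`, `λ̂_n(z[j ↦ v], D)·μ_j(z_j) = λ̂_n(z, D)·μ_j(v)` for every `n`,
`z`, `D`, `j ∉ D` and `v` in the sector of `z_j`. [ours] -/
theorem sector_fresh_lawAt (hμ : ∀ k x, 0 < μ k x) (hφℓ : ∀ r u, ℓ (φ r u) = ℓ u) {cL : Fin m → L → ℝ} (hcL : ∀ r b, 0 < cL r b)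
    (hexact : ∀ r u, μ (κ r).succ (φ r u) = cL r (ℓ u) * μ 0 u)
    (hM0 : ∀ u v, M 0 u v = μ 0 v) (hstat : ∀ k : Fin (K + 1), k ≠ 0 → ∀ v, ∑ u, μ k u * M k u v = μ k v)
    (hconf : ∀ k : Fin (K + 1), k ≠ 0 → ∀ u v, ℓ u ≠ ℓ v → M k u v = 0)
    {α : Fin m → (Fin (K + 1) → S) → ℝ}
    (hα : ∀ r z, α r z = min 1 (tensorFun μ (edgeFlowSwap (φ r) 0 (κ r).succ z) / tensorFun μ z))
    {Ph : (Fin (K + 1) → S) × Finset (Fin (K + 1)) → (Fin (K + 1) → S) × Finset (Fin (K + 1)) → ℝ}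
    (hPh : ∀ a b, Ph a b = ∑ r : Fin m, t / m *
        ((fun r a => α r a.1) r a * (if b.1 = edgeFlowSwap (φ r) 0 (κ r).succ a.1
            ∧ b.2 = a.2.image (Equiv.swap (0 : Fin (K + 1)) (κ r).succ) then (1 : ℝ) else 0)
          + (α r a.1 - (fun r a => α r a.1) r a) * (if b.1 = edgeFlowSwap (φ r) 0 (κ r).succ a.1
            ∧ b.2 = (fun (_ : Fin m) (D : Finset (Fin (K + 1))) => D) r a.2 then (1 : ℝ) else 0)
          + (1 - α r a.1) * (if b.1 = a.1 ∧ b.2 = (fun (_ : Fin m) (D : Finset (Fin (K + 1))) => D) r a.2 then (1 : ℝ) else 0))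
      + (1 - t) * ∑ k : Fin (K + 1), w k * (coordKernel M k a.1 b.1
          * (if b.2 = (if k = 0 then a.2.erase 0 else a.2) then (1 : ℝ) else 0)))
    (x : Fin (K + 1) → S) :
    ∀ (n : ℕ) (z : Fin (K + 1) → S) (D : Finset (Fin (K + 1))) (j : Fin (K + 1)) (v : S), j ∉ D → ℓ v = ℓ (z j) →
      lawAt Ph (Pi.single (x, (univ : Finset (Fin (K + 1)))) 1) n (update z j v, D) * μ j (z j)
        = lawAt Ph (Pi.single (x, (univ : Finset (Fin (K + 1)))) 1) n (z, D) * μ j v := by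
  intro n
  induction n with
  | zero =>
    intro z D j v hj _
    have hD : D ≠ univ := fun h => hj (h ▸ mem_univ j)
    rw [lawAt_zero, Pi.single_eq_of_ne (fun h => hD (Prod.mk.inj h).2),
      Pi.single_eq_of_ne (fun h => hD (Prod.mk.inj h).2), zero_mul, zero_mul]
  | succ n ih =>
    intro z D j v hj hv
    rw [lawAt_succ]
    exact sector_fresh_step κ φ ℓ hμ hφℓ hcL hexact hM0 hstat hconf hα hPh ih z D j v hj hv

end SFreshness

end Summit.Ventures.LatticeQCDFlow.Scaling

end
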